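import Literature.NumberTheory.GaloisRepresentations.DiscreteRepFrobenius
import Literature.NumberTheory.Automorphic.ChebotarevArtinRepHolds
import HarnessLib

/-!
# Separating a semisimple mod-`p` Galois representation from finitely many others by finitely
# many Frobenius characteristic polynomials (Deligne–Serre 1974, Lemme 3.2 — unconditional form,
# ramified places allowed)

Topic `Literature/NumberTheory/GaloisRepresentations`; a *proofs* file (theorems only, no named
fact, no `sorry`; D-0026), sibling of `DiscreteRepFrobenius` (Deligne–Serre, *Formes modulaires de
poids 1*, §3.1 cases (a)–(b) and Lemme 3.2, p. 513, for coefficient fields carrying the DISCRETE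
topology).  Two refinements of that file, both used by the Serre-weight exclusion of the route
`TameQuarticManinParity` (items H1/L31: `ρ̄_{E,3}` of Serre weight `6` against the finitely many
mod-`3` representations of weight-two newforms of level dividing `N/3`):

* **The ramification hypothesis is superfluous.**  `charpoly_eq_of_hasFrobCharpolyAt_eventually'`,
  `nonempty_equiv_of_hasFrobCharpolyAt_eventually_of_discrete'`,
  `exists_not_hasFrobCharpolyAt_of_isEmpty_equiv'` — the statements of `DiscreteRepFrobenius`
  with the hypothesis "`r`, `r'` unramified at `v`" dropped: a common characteristic polynomial of
  ALL arithmetic Frobenii at `v` (the tree's `HasFrobCharpolyAt`, which quantifies over every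
  `σ` with `IsArithFrobAt σ 𝔓`, `𝔓 ∣ v` — the whole Frobenius coset of inertia) at all but
  finitely many `v` already forces equal characteristic polynomials everywhere (the Frobenius
  cosets are dense: `absoluteGaloisGroup.frobenius_dense`, Chebotarev, PROVED in the tree as
  `Automorphic.chebotarev_artinRep_holds`), hence isomorphism of the semisimple representations
  (Brauer–Nesbitt, `Representation.nonempty_equiv_of_charpoly_eq`).  This matters when one of the
  two representations is only known through its Frobenius polynomials (e.g. a `ρ̄` handed over as
  "`charpoly ρ̄(Frob_p) = X² − a_p X + p` for `p ∤ N`", with no ramification datum).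
* **Finite separating sets.**  `exists_finset_forall_nonempty_equiv_of_hasFrobCharpolyAt` — for a
  semisimple `r` and a FINITE family `(r_i)` of semisimple representations over a discrete field,
  and any finite set `S` of places to avoid, there is a finite set `S₀` of places outside `S` such
  that every `r_i` sharing with `r` a Frobenius characteristic polynomial at each `v ∈ S₀` is
  isomorphic to `r` (one separating place per non-isomorphic `r_i`, op. cit. Lemme 3.2 read
  contrapositively; Deligne–Serre 8.6 use the same device: "il existe un ensemble fini `X` de
  nombres premiers … tel que …").  All statements UNCONDITIONAL (Chebotarev discharged).

## References

* P. Deligne, J.-P. Serre, *Formes modulaires de poids 1*, Ann. Sci. ÉNS (4) 7 (1974), 507–530: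
  §3.1, Lemme 3.2 and Remarque 3.3 (p. 513); §8.6 (p. 526). [DeligneSerreASENS1974]
* N. Bourbaki, *Algèbre* VIII (2012), § 20 n° 6, Thm. 2, Cor. 1 (Brauer–Nesbitt).
  [BourbakiAlgebreVIII2012]
-/

noncomputable section

open scoped NumberField
open IsDedekindDomain Field

namespace Literature.NumberTheory.GaloisRepresentations

section Discrete

variable {K : Type} [Field K] [NumberField K] {A : Type*} [Field A] [TopologicalSpace A]
  {n : ℕ}

omit [NumberField K] in
/-- The characteristic polynomial of `σ` in the representation on `Aⁿ` underlying a framed Galois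
representation is the matrix characteristic polynomial `FramedRep.charpoly` (Mathlib
`Matrix.charpoly_toLin'`). [folklore] -/
private theorem FramedGaloisRep.charpoly_toRepresentation' [IsTopologicalRing A]
    (r : FramedGaloisRep K A n) (σ : absoluteGaloisGroup K) :
    (r.toGaloisRep.toRepresentation σ).charpoly = FramedRep.charpoly r σ := by
  have h : r.toGaloisRep.toRepresentation σ =
      Matrix.toLin' ((r σ : GL (Fin n) A) : Matrix (Fin n) (Fin n) A) := by
    apply LinearMap.ext
    intro v
    rw [FramedRep.toContinuousRep_toRepresentation, FramedRep.toRepresentation_apply_apply,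
      Matrix.toLin'_apply]
  rw [h, Matrix.charpoly_toLin']
  rfl

/-- **Frobenius characteristic polynomials at almost all places determine all characteristic
polynomials (discrete coefficients; no ramification hypothesis).**  For a number field `K`, a
field `A` with the DISCRETE topology and continuous `r, r' : Γ_K → GL_n(A)` admitting, at all but
finitely many finite places `v`, a common characteristic polynomial of every arithmetic Frobenius at
`v` (`HasFrobCharpolyAt`), one has `det(X − r(σ)) = det(X − r'(σ))` for every `σ ∈ Γ_K`: the
coincidence set is closed (continuous map to a discrete space) and contains the dense set of
Frobenius elements at the good places (`absoluteGaloisGroup.frobenius_dense`, Chebotarev —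
discharged by `Automorphic.chebotarev_artinRep_holds`).  The variant of
`charpoly_eq_of_hasFrobCharpolyAt_eventually` without "unramified at `v`" (Deligne–Serre 1974,
proof of Lemme 3.2). [cite: DeligneSerreASENS1974, §3.1 and Lemme 3.2 (p. 513)] -/
theorem FramedGaloisRep.charpoly_eq_of_hasFrobCharpolyAt_eventually' [DiscreteTopology A]
    (r r' : FramedGaloisRep K A n)
    (h : ∀ᶠ v : HeightOneSpectrum (𝓞 K) in Filter.cofinite,
      ∃ P : Polynomial A, r.HasFrobCharpolyAt v P ∧ r'.HasFrobCharpolyAt v P)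
    (σ : absoluteGaloisGroup K) :
    FramedRep.charpoly r σ = FramedRep.charpoly r' σ := by
  classical
  set S : Set (HeightOneSpectrum (𝓞 K)) :=
    {v | ¬ ∃ P : Polynomial A, r.HasFrobCharpolyAt v P ∧ r'.HasFrobCharpolyAt v P} with hSdef
  have hS : S.Finite := Filter.eventually_cofinite.1 h
  set D : Set (absoluteGaloisGroup K) :=
    {σ | ∃ v ∉ S, ∃ 𝔓 ∈ v.primesAbove, IsArithFrobAt (𝓞 K) σ 𝔓} with hDdef
  -- characteristic polynomials agree on the Frobenius elements over good places
  have hF : D ⊆ {σ | FramedRep.charpoly r σ = FramedRep.charpoly r' σ} := by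
    rintro τ ⟨v, hv, 𝔓, h𝔓, hτ⟩
    simp only [hSdef, Set.mem_setOf_eq, not_not] at hv
    obtain ⟨P, hP, hP'⟩ := hv
    have h1 : FramedRep.charpoly r τ = P := hP 𝔓 h𝔓 τ hτ
    have h2 : FramedRep.charpoly r' τ = P := hP' 𝔓 h𝔓 τ hτ
    show FramedRep.charpoly r τ = FramedRep.charpoly r' τ
    rw [h1, h2]
  -- the coincidence set is closed: preimage of a subset of a discrete space under a continuous map
  have hcont : Continuous fun τ : absoluteGaloisGroup K ↦
      (((r τ : GL (Fin n) A) : Matrix (Fin n) (Fin n) A),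
        ((r' τ : GL (Fin n) A) : Matrix (Fin n) (Fin n) A)) :=
    (Units.continuous_val.comp (map_continuous r)).prodMk
      (Units.continuous_val.comp (map_continuous r'))
  have hclosed : IsClosed {τ : absoluteGaloisGroup K |
      FramedRep.charpoly r τ = FramedRep.charpoly r' τ} := by
    have hset : {τ : absoluteGaloisGroup K | FramedRep.charpoly r τ = FramedRep.charpoly r' τ} =
        (fun τ : absoluteGaloisGroup K ↦
          (((r τ : GL (Fin n) A) : Matrix (Fin n) (Fin n) A),
            ((r' τ : GL (Fin n) A) : Matrix (Fin n) (Fin n) A))) ⁻¹'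
          {q : Matrix (Fin n) (Fin n) A × Matrix (Fin n) (Fin n) A | q.1.charpoly = q.2.charpoly} :=
      rfl
    rw [hset]
    exact (isClosed_discrete _).preimage hcont
  have hmem : σ ∈ closure D := by
    rw [(absoluteGaloisGroup.frobenius_dense Automorphic.chebotarev_artinRep_holds K S
      hS).closure_eq]
    exact Set.mem_univ σ
  exact hclosed.closure_subset_iff.2 hF hmem

/-- **Deligne–Serre 1974, Lemme 3.2 (discrete coefficients; no ramification hypothesis):
semisimple Galois representations with the same Frobenius characteristic polynomials at almost all
places are isomorphic.**  For a number field `K`, a field `A` with the discrete topology and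
continuous semisimple `r, r' : Γ_K → GL_n(A)` admitting a common characteristic polynomial of
arithmetic Frobenius at all but finitely many finite places, there is an isomorphism of the
underlying continuous representations (Chebotarev — `charpoly_eq_of_hasFrobCharpolyAt_eventually'`
— and Brauer–Nesbitt, `Representation.nonempty_equiv_of_charpoly_eq`).  Unconditional.
[cite: DeligneSerreASENS1974, Lemme 3.2 (p. 513)] -/
theorem FramedGaloisRep.nonempty_equiv_of_hasFrobCharpolyAt_eventually_of_discrete'
    [IsTopologicalRing A] [DiscreteTopology A] (r r' : FramedGaloisRep K A n)
    (hr : r.toGaloisRep.IsSemisimple) (hr' : r'.toGaloisRep.IsSemisimple)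
    (h : ∀ᶠ v : HeightOneSpectrum (𝓞 K) in Filter.cofinite,
      ∃ P : Polynomial A, r.HasFrobCharpolyAt v P ∧ r'.HasFrobCharpolyAt v P) :
    Nonempty (ContinuousRep.Equiv r.toGaloisRep r'.toGaloisRep) := by
  have hall := FramedGaloisRep.charpoly_eq_of_hasFrobCharpolyAt_eventually' r r' h
  have h' : ∀ σ : absoluteGaloisGroup K,
      (r.toGaloisRep.toRepresentation σ).charpoly =
        (r'.toGaloisRep.toRepresentation σ).charpoly := by
    intro σ
    rw [FramedGaloisRep.charpoly_toRepresentation', FramedGaloisRep.charpoly_toRepresentation',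
      hall σ]
  haveI : r.toGaloisRep.toRepresentation.IsSemisimpleRepresentation := hr
  haveI : r'.toGaloisRep.toRepresentation.IsSemisimpleRepresentation := hr'
  obtain ⟨e⟩ :=
    Literature.RepresentationTheory.Semisimple.Representation.nonempty_equiv_of_charpoly_eq _ _ h'
  exact ⟨⟨e, LinearMap.continuous_on_pi e.toLinearEquiv.toLinearMap,
    LinearMap.continuous_on_pi e.toLinearEquiv.symm.toLinearMap⟩⟩

/-- Finite-exceptional-set form of `nonempty_equiv_of_hasFrobCharpolyAt_eventually_of_discrete'`
(Deligne–Serre, Remarque 3.3), no ramification hypothesis.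
[cite: DeligneSerreASENS1974, Lemme 3.2 and Remarque 3.3 (p. 513)] -/
theorem FramedGaloisRep.nonempty_equiv_of_hasFrobCharpolyAt_of_finite_of_discrete'
    [IsTopologicalRing A] [DiscreteTopology A] {S : Set (HeightOneSpectrum (𝓞 K))}
    (hS : S.Finite) (r r' : FramedGaloisRep K A n)
    (hr : r.toGaloisRep.IsSemisimple) (hr' : r'.toGaloisRep.IsSemisimple)
    (hST : ∀ v ∉ S, ∃ P : Polynomial A, r.HasFrobCharpolyAt v P ∧ r'.HasFrobCharpolyAt v P) :
    Nonempty (ContinuousRep.Equiv r.toGaloisRep r'.toGaloisRep) :=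
  FramedGaloisRep.nonempty_equiv_of_hasFrobCharpolyAt_eventually_of_discrete' r r' hr hr'
    (Filter.mem_of_superset hS.compl_mem_cofinite fun v hv ↦ hST v hv)

/-- **Non-isomorphic semisimple representations are separated by a Frobenius characteristic
polynomial outside any finite set of places** (contrapositive of Lemme 3.2, discrete coefficients,
no ramification hypothesis): if `r`, `r'` are semisimple and NOT isomorphic, then for every finite
`S` there is a place `v ∉ S` at which they admit NO common characteristic polynomial of
arithmetic Frobenius. [cite: DeligneSerreASENS1974, Lemme 3.2 and Remarque 3.3 (p. 513)] -/
theorem FramedGaloisRep.exists_not_hasFrobCharpolyAt_of_isEmpty_equiv' [IsTopologicalRing A]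
    [DiscreteTopology A] {S : Set (HeightOneSpectrum (𝓞 K))} (hS : S.Finite)
    (r r' : FramedGaloisRep K A n)
    (hr : r.toGaloisRep.IsSemisimple) (hr' : r'.toGaloisRep.IsSemisimple)
    (hne : IsEmpty (ContinuousRep.Equiv r.toGaloisRep r'.toGaloisRep)) :
    ∃ v ∉ S, ¬ ∃ P : Polynomial A, r.HasFrobCharpolyAt v P ∧ r'.HasFrobCharpolyAt v P := by
  by_contra hcon
  push Not at hcon
  obtain ⟨e⟩ := FramedGaloisRep.nonempty_equiv_of_hasFrobCharpolyAt_of_finite_of_discrete' hS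
    r r' hr hr' fun v hv ↦ hcon v hv
  exact hne.false e

/-- **A finite separating set of places for a finite family** (Deligne–Serre 1974, Lemme 3.2
read contrapositively, as used in op. cit. 8.6).  Let `A` be a field with the discrete topology,
`r : Γ_K → GL_n(A)` continuous and semisimple, `(r i)_{i ∈ I}` a FINITE family of continuous
semisimple representations, and `S` a finite set of finite places.  Then there is a finite set
`S₀` of places, disjoint from `S`, such that every `r i` admitting with `r` a common
characteristic polynomial of arithmetic Frobenius at each `v ∈ S₀` is isomorphic to `r`.  Proof:
for each `i` with `r ≇ r i` pick one separating place outside `S`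
(`exists_not_hasFrobCharpolyAt_of_isEmpty_equiv'`) and let `S₀` be the set of these.
Unconditional. [cite: DeligneSerreASENS1974, Lemme 3.2 (p. 513) and 8.6 (p. 526)] -/
theorem FramedGaloisRep.exists_finset_forall_nonempty_equiv_of_hasFrobCharpolyAt
    [IsTopologicalRing A] [DiscreteTopology A] {S : Set (HeightOneSpectrum (𝓞 K))}
    (hS : S.Finite) (r : FramedGaloisRep K A n) (hr : r.toGaloisRep.IsSemisimple)
    {I : Type*} [Finite I] (r' : I → FramedGaloisRep K A n)
    (hr' : ∀ i, (r' i).toGaloisRep.IsSemisimple) :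
    ∃ S₀ : Finset (HeightOneSpectrum (𝓞 K)), (∀ v ∈ S₀, v ∉ S) ∧
      ∀ i, (∀ v ∈ S₀, ∃ P : Polynomial A, r.HasFrobCharpolyAt v P ∧ (r' i).HasFrobCharpolyAt v P) →
        Nonempty (ContinuousRep.Equiv r.toGaloisRep (r' i).toGaloisRep) := by
  classical
  haveI : Fintype I := Fintype.ofFinite I
  -- one separating place for each non-isomorphic member of the family
  have hsep : ∀ i, IsEmpty (ContinuousRep.Equiv r.toGaloisRep (r' i).toGaloisRep) →
      ∃ v : HeightOneSpectrum (𝓞 K), v ∉ S ∧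
        ¬ ∃ P : Polynomial A, r.HasFrobCharpolyAt v P ∧ (r' i).HasFrobCharpolyAt v P := by
    intro i hne
    obtain ⟨v, hvS, hv⟩ := FramedGaloisRep.exists_not_hasFrobCharpolyAt_of_isEmpty_equiv' hS
      r (r' i) hr (hr' i) hne
    exact ⟨v, hvS, hv⟩
  choose v hvS hv using hsep
  let T : I → Finset (HeightOneSpectrum (𝓞 K)) := fun i ↦
    if h : IsEmpty (ContinuousRep.Equiv r.toGaloisRep (r' i).toGaloisRep) then {v i h} else ∅
  refine ⟨Finset.univ.biUnion T, ?_, ?_⟩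
  · intro w hw
    obtain ⟨i, -, hi⟩ := Finset.mem_biUnion.mp hw
    by_cases h : IsEmpty (ContinuousRep.Equiv r.toGaloisRep (r' i).toGaloisRep)
    · simp only [T, dif_pos h, Finset.mem_singleton] at hi
      rw [hi]
      exact hvS i h
    · simp only [T, dif_neg h] at hi
      exact absurd hi (Finset.notMem_empty w)
  · intro i hi
    by_contra hne
    rw [not_nonempty_iff] at hne
    have hmem : v i hne ∈ Finset.univ.biUnion T :=
      Finset.mem_biUnion.mpr ⟨i, Finset.mem_univ i, by simp only [T, dif_pos hne]; simp⟩
    exact hv i hne (hi _ hmem)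

end Discrete

end Literature.NumberTheory.GaloisRepresentations

end
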